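import Summits.QuantumFields.YangMills.Theorems.BalabanUVNodesN11ChiTopRegularity
import Summits.QuantumFields.YangMills.Theorems.BalabanUVNodesN11StepWeightSupportOfRecord
import Summits.QuantumFields.YangMills.Theorems.BalabanUVNodesN11ApproxFluctPlaquetteComparison

/-!
# DAG node N11 — THE LATTICE HALF OF THE BRIDGE `hbridge` IN PLAQUETTE CURRENCY: (3.2) + (3.3) AT A χ-CUBE ⇒ THE OLD FIELD'S LEVEL-`k`
# PLAQUETTES NEAR EVERY COARSE BOND OF THE CUBE ARE `(4·2δ_k + 2ε_{k+1}∕L²)`-SMALL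

HEADER — WORK-UNIT METADATA.  Cell `pub-ymgap`, YM-PLAN Track A (HUMAN RULING D-0062), width seat `pub-ymgap-dag-n11-w2` (g4; WIDTH SEAT 2∕4 on NODE N11 [B14] =
[Balaban1988Convergent] = [III]), route `BalabanUVNodes` (rev 29).  Helper lane of K1⁷ `StabilityBAtRecordR13SepCoPH` = stmt-QuantumFields-20542 (the jail key of this
seat; K1⁹ stmt-QuantumFields-27364 `…SepCoPHV` is the face of record — MIS-KEY∕VALID rule R463 (4)(a): valid lineage by name), filed `--kind proof --supports
stmt-QuantumFields-20542 --as helper`, COUNT-NEUTRAL.  [B7] = [Balaban1985Averaging], [I] = [Balaban1987RG1].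

WHY THIS FILE.  Every old-branch (O3′) theorem of the -d ∕ -w2 ∕ -w6 lanes displays a SUPPORT CLAUSE `hwS` («wherever the step weight `w_k(s′)(U, V′)` is non-zero,
the level-`k` variables of `U` at the bonds of `Ω_{k+1}(s′)` sit in the chart's windows»); this seat's `…N11StepWeightSupportOfRecord` (p638096) proved its
definition-unpacking half — `w_k(s′) ≠ 0` forces, at every χ-cube `□ ⊆ Ω_{k+1}(s′)`, the (3.2) event `|U_{k+1,□}(V′)(∂p) − 1| < ε_{k+1}η_{k+1}²` on `p ⊂ □^∼` and the
(3.3) event `|U(b)·V^{(k)}_□(V′)(b)⁻¹ − 1| < 2δ_k` on `b ∈ (□^{∼2})^{(k)*}`, `V^{(k)}_□ = M^k(U_{k+1,□})` ((3.4)) — and `…PrivateInnerChartOfSupport` displays the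
remaining LATTICE step as `hbridge`.  dag-n11-w6's chart on the central window reads the support clause in PLAQUETTE currency
(`…N11PrivateChartOfCentralWindow.loops_small_of_plaqSmallOn_blocks` ∕ `exists_chart_transportOfRecord_ae_eq_of_plaqSmallSupport`: «every level-`k` plaquette `q` of `U`
with `blockOf q₋ ∈ {c′₋ − e, c′₋, c′₊}` is `δ`-small»).  THIS FILE proves the lattice step between the two: (3.2) + (3.3) at a χ-cube `□` ⇒ that plaquette letter at
every coarse bond `c′` with an endpoint in `□`, threshold `4·(2δ_k) + 2ε_{k+1}∕L²`.  Ingredients, all BY NAME: dag-n08-w2 g10's four-bond telescoping under (3.3)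
(`…N11ApproxFluctPlaquetteComparison.dist1_plaqHol_lt_of_smallApproxFluct`, landed 14:03Z — its file leaves exactly the BACKGROUND row «small level-`k` plaquettes of
`M^k(U_{k+1,□}(V′))`» and a COVERING row displayed; THIS file discharges the background row where it is derivable — at the plaquettes whose box-closed hull stays inside
`□^∼` — by dag-n11-d g12's LOCAL k-fold [B7] Proposition 2 (`…N11LocalIteratedAveraging.plaqSmallOn_iter_avOfRecord_of_boxClosed_top`, uniform in `k`) run on g12's
box-closed hull of a cube collar (`…N11ChiTopRegularity.hull_boxClosed`, `hullBottom_subset_plaqInside`), for an ARBITRARY collar width and with NO solvability letter (the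
(3.4) field IS an average), plus torus-cover arithmetic (`cover_add_eq_embIter_add`) for the corner and the four bonds of a plaquette near a coarse bond).

WHAT THIS FILE PROVES (0 `sorry`, 0 `def`).
§1 ★ `plaqHol_iter_avOfRecord_small_of_collar` — [B7] Prop. 2, local and k-fold, on the hull of a collar of width `w₀`: `PlaqSmallOn (plaqInside □^∼) (α₀η_k²) U₀` and
   `w₀ + R₀·Σ_{l<k}L^l + 2 ≤ S` (`R₀ = (d+4)L + 2`) ⇒ `|M^k U₀(∂q) − 1| < 2α₀` for every `k`-plaquette whose corner `ι_k q₋` is covered by the `w₀`-collar of `□`.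
§2 cover geometry: `cubeExt_mono`, `mem_cubeExt_add_of_near`, ★ `exists_offset_emb_blockOf` (`x = emb (blockOf x) + a`, labels `|e| ≤ (L−1)∕2`: [I] (0.1)'s centred blocks),
   `exists_cover_embIter_of_cover_blockOf`, `abs_single_one_le`, `exists_cover_embIter_shift ∕ _unshift`, ★ `exists_cover_corner_of_near_bond` (a `k`-plaquette based in the three blocks around a
   coarse bond with an endpoint in `□^{∼n}` has its corner in the `(nS + 3L^{k+1})`-collar), `embIter_add_mem_cubeEnl`.
§3 ★★ `plaqHol_small_near_of_sect3Events` — at def-T's `sect3DataOfRecord`: (3.2) `PlaqSmallOn (plaqT □) (ε_{k+1}η_{k+1}²) (UkLoc □ V′)` ∧ (3.3) `SmallApproxFluct … (2δ) U V′ □`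
   + the cube-size and Prop.-2 numerics (`α₀ := ε_{k+1}∕L²`) ⇒ for every coarse bond `c′` with an endpoint in `□` and every `q` with `blockOf q₋ ∈ {c′₋ − e, c′₋, c′₊}`:
   `|U(∂q) − 1| < 4·(2δ) + 2ε_{k+1}∕L²`.
§4 ★★ `plaqHol_small_near_of_wOfRecord_ne_zero` — with `…N11StepWeightSupportOfRecord.support_of_wOfRecord_ne_zero`: `w_k(s′)(U, V′) ≠ 0`, `0 < sideD` and a χ-cube cover of
   `Ω_{k+1}(s′)` (displayed, g12's located `L·M₂ ∣ M` reading) ⇒ the same at every coarse bond with an endpoint in `Ω_{k+1}(s′)`, threshold `4·(2δ_k) + 2ε_{k+1}∕L²`.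

HONEST FRAMING.  Helper lane, count-neutral; lattice bookkeeping + [B7] Prop. 2 (in the tree, g12) BY NAME; the window numerics `((d+2)L)²∕4·(8δ_k + 2ε_{k+1}∕L²) ≤ α` of the
consumer, the Prop.-2 numerics and the cube cover stay DISPLAYED; NO minimiser regularity and NO estimate of [III] is asserted; the support clause `hwS` of an ABSTRACT chart is not
touched (only its plaquette-currency letter is produced).  N11 NOT discharged; K1⁷ ∕ K1⁹ NOT closed, no registered stub touched; counts unmoved (typed 28∕28 · discharged 5∕27 ·
A 5∕28).  One finite four-torus programme at fixed `ε = L^{−K}` — NOT ℝ⁴, NOT OS, NOT a mass gap, NOT Clay.  No `sorry`, `axiom`, `def`, `instance`, `notation`.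
Sources: [III] (3.2)–(3.5) p.265, (2.16)–(2.17) p.257; [B7] (19)–(20) p.21, Prop. 2 (52)–(54) p.26; [I] (0.1), (0.3) p.251–252, (0.4) p.253.
-/

noncomputable section

open scoped BigOperators Matrix.Norms.L2Operator

namespace Summit.QuantumFields.YangMills.Theorems.BalabanUVNodesN11PlaqSmallOfSect3Events

open Literature.MathematicalPhysics.QuantumFieldTheory.Balaban1983to89
open T4Continuum BlockAveraging AveragingRT ExpMeanLog BlockAveragingEMLProp2
open B15Eq112TorusCover (cover cover_apply)
open B14DomainGeom (Pt)
open B14.Eq213MaximalDomains (cubeExt)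
open B15DeterminingSets (embIter pts mem_pts)
open Node00 (cubeEnl plaqInside)
open Summit.QuantumFields.YangMills.BalabanUVNodes.N20LCSAvgDominationRegion (boxRegion)
open Summit.QuantumFields.YangMills.Theorems.BalabanUVNodesN11ChiTopRegularity (cover_add_eq_embIter_add zero_shift_apply_eq_intCast
  zero_unshift_apply_eq_intCast hull_boxClosed hullBottom_subset_plaqInside)
open Summit.QuantumFields.YangMills.Theorems.BalabanUVNodesN11LocalIteratedAveraging (plaqSmallOn_iter_avOfRecord_of_boxClosed_top)
open Summit.QuantumFields.YangMills.Theorems.BalabanUVNodesN11ApproxFluctPlaquetteComparison (dist1_plaqHol_lt_of_smallApproxFluct)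

/-! ## §1  [B7] Proposition 2, local and k-fold, on the hull of a cube collar of arbitrary width -/

section Collar

open Node00

variable (F : T4Family) (N : ℕ) [NeZero N]

/-- **★ THE k-FOLD AVERAGE OF A LOCALLY SMALL FINE FIELD HAS SMALL TOP-SCALE PLAQUETTES ON A COLLAR** (dag-n11-d g12's local [B7] Prop. 2 on g12's box-closed hull, for an
arbitrary base width `w₀`, NO solvability letter): if `|U₀(∂p) − 1| < α₀η_k²` for the fine plaquettes inside `□^∼` (`□` the `S`-cube of index `a₀`), the Prop.-2 numerics hold,
and `w₀ + R₀·Σ_{l<k}L^l + 2 ≤ S` (`R₀ = (d+4)L + 2`), then `|M^k U₀(∂q) − 1| < 2α₀` for every `k`-plaquette `q` whose corner `ι_k q₋` is covered by a point of the `w₀`-collar of `□`.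
[cite: Balaban1985Averaging, Prop. 2 (52)-(54) p.26; Balaban1988Convergent, (3.4) p.265; Balaban1987RG1, (0.1) p.251] -/
theorem plaqHol_iter_avOfRecord_small_of_collar (K k : ℕ) {S : ℕ} (a₀ : Pt (F.P K).d) (w₀ : ℕ)
    (hR : w₀ + (((F.P K).d + 4) * (F.P K).L + 2) * (∑ l ∈ Finset.range k, (F.P K).L ^ l) + 2 ≤ S)
    {α₀ : ℝ} (hα : 0 < α₀) (hα3 : (143 * (((((F.P K).d + 4 : ℕ) : ℝ)) ^ 2 / 4) ^ 2) * α₀ ≤ 1 / 3)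
    (hα2 : 2 * α₀ ≤ 2 * deltaSU (Fin N) / ((((F.P K).d + 4) * (F.P K).L : ℕ) : ℝ) ^ 2)
    {U₀ : GaugeField (F.P K) 0 (SU N)} (hloc : PlaqSmallOn (plaqInside (cubeEnl (F.P K) S a₀ 1)) (α₀ * (F.P K).eta k ^ 2) U₀)
    {q : Plaq (F.P K) k} (hq : ∃ z ∈ cubeExt S a₀ (w₀ : ℤ), cover (F.P K) z = embIter k q.src) :
    dist1 (GaugeField.plaqHol (Averaging.iter (avOfRecord F N K) k U₀) q) < 2 * α₀ := by
  set Sf : (i : ℕ) → Set (Plaq (F.P K) i) := fun i =>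
    {q | ∃ z ∈ cubeExt S a₀ ((w₀ + (((F.P K).d + 4) * (F.P K).L + 2) * ∑ l ∈ Finset.Ico i k, (F.P K).L ^ l : ℕ) : ℤ),
      cover (F.P K) z = embIter i q.src} with hSf
  have hS : ∀ i, i < k → ∀ q ∈ Sf (i + 1), (↑(boxRegion (emb q.src) (((F.P K).d + 4) * (F.P K).L + 2)) : Set (Plaq (F.P K) i)) ⊆ Sf i :=
    hull_boxClosed S a₀ w₀ k
  have hqk : q ∈ Sf k := by
    obtain ⟨z, hz, hzq⟩ := hq
    refine ⟨z, ?_, hzq⟩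
    simpa only [Finset.Ico_self, Finset.sum_empty, mul_zero, add_zero] using hz
  have h0 : Sf 0 ⊆ plaqInside (cubeEnl (F.P K) S a₀ 1) := by
    refine hullBottom_subset_plaqInside S a₀ ?_
    rw [one_mul, ← Finset.range_eq_Ico]
    exact hR
  have h52 : PlaqSmallOn (Sf 0) (α₀ * (F.P K).eta k ^ 2) U₀ := fun q hq => hloc q (h0 hq)
  exact plaqSmallOn_iter_avOfRecord_of_boxClosed_top F N K k Sf hS hα hα3 hα2 h52 q hqk

end Collar

/-! ## §2  Cover geometry: centred offsets, unit steps, and the corner of a plaquette near a coarse bond -/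

section Geometry

variable {P : Params}

/-- Widening a collar. [folklore] -/
theorem cubeExt_mono {S : ℕ} (a : Pt P.d) {w w' : ℤ} (h : w ≤ w') : cubeExt S a w ⊆ cubeExt S a w' := by
  intro z hz i
  obtain ⟨h1, h2⟩ := hz i
  constructor <;> linarith

/-- A point coordinatewise within `w` of a collar point lies in the `w`-wider collar. [folklore] -/
theorem mem_cubeExt_add_of_near {S : ℕ} {a z z' : Pt P.d} {r w : ℤ} (hz : z ∈ cubeExt S a r) (h : ∀ i, |z' i - z i| ≤ w) :
    z' ∈ cubeExt S a (r + w) := by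
  intro i
  obtain ⟨h1, h2⟩ := hz i
  have h3 := h i
  rw [abs_le] at h3
  constructor <;> linarith

/-- **★ THE CENTRED OFFSET OF A FINE SITE IN ITS BLOCK**: `x − emb (blockOf x)` has integer labels `e` with `|e_ν| ≤ (L−1)∕2` — `blockOf` is division by `L` and `emb` the
centre `nL + (L−1)∕2` of the block ([I] (0.1)'s centred cubes, `L` odd; standing range). [cite: Balaban1987RG1, (0.1) p.251, (0.3) p.252] -/
theorem exists_offset_emb_blockOf {j : ℕ} (hj : j + 1 ≤ P.m + P.K) (x : Site P j) :
    ∃ e : Fin P.d → ℤ, (∀ ν, |e ν| ≤ (((P.L - 1) / 2 : ℕ) : ℤ)) ∧ ∀ ν, (x - emb (blockOf x)) ν = ((e ν : ℤ) : ZMod (P.sitesPerDir j)) := by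
  refine ⟨fun ν => (((x ν).val % P.L : ℕ) : ℤ) - (((P.L - 1) / 2 : ℕ) : ℤ), fun ν => ?_, fun ν => ?_⟩
  · have hlt : (x ν).val % P.L < P.L := Nat.mod_lt _ P.L_pos
    have hL := two_mul_half_add_one P
    dsimp only
    rw [abs_le]
    constructor <;> omega
  · have hv : (emb (blockOf x)) ν = ((((x ν).val / P.L) * P.L + (P.L - 1) / 2 : ℕ) : ZMod (P.sitesPerDir j)) := by
      show ((((blockOf x) ν).val * P.L + (P.L - 1) / 2 : ℕ) : ZMod (P.sitesPerDir j)) = _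
      rw [Site.val_blockOf hj]
    have hx : x ν = (((x ν).val : ℕ) : ZMod (P.sitesPerDir j)) := (ZMod.natCast_zmod_val (x ν)).symm
    have hdm : (x ν).val = (x ν).val / P.L * P.L + (x ν).val % P.L := (Nat.div_add_mod' _ _).symm
    show x ν - emb (blockOf x) ν = _
    rw [sub_eq_iff_eq_add', hv]
    conv_lhs => rw [hx, hdm]
    simp only [Nat.cast_add, Nat.cast_mul, Int.cast_sub, Int.cast_natCast]
    ring

/-- **FROM THE BLOCK TO THE SITE**: if `z` covers `ι_{j+1}(blockOf x)`, a point within `L^j·(L−1)∕2 ≤ L^{j+1}` of `z` covers `ι_j x`. [cite: Balaban1987RG1, (0.1) p.251, (0.3) p.252] -/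
theorem exists_cover_embIter_of_cover_blockOf {j : ℕ} (hj : j + 1 ≤ P.m + P.K) {S : ℕ} {a₀ : Pt P.d} {w : ℕ} (x : Site P j) {z : Pt P.d}
    (hz : z ∈ cubeExt S a₀ (w : ℤ)) (hzx : cover P z = embIter (j + 1) (blockOf x)) :
    ∃ z' ∈ cubeExt S a₀ ((w + P.L ^ (j + 1) : ℕ) : ℤ), cover P z' = embIter j x := by
  obtain ⟨e, he, hxe⟩ := exists_offset_emb_blockOf hj x
  have hzx' : cover P z = embIter j (emb (blockOf x)) := hzx
  refine ⟨z + fun ν => (P.L : ℤ) ^ j * e ν,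
    cubeExt_mono a₀ ?_ (mem_cubeExt_add_of_near (w := (P.L : ℤ) ^ j * (((P.L - 1) / 2 : ℕ) : ℤ)) hz fun ν => ?_), ?_⟩
  · have hh : (((P.L - 1) / 2 : ℕ) : ℤ) ≤ (P.L : ℤ) := by have := two_mul_half_add_one P; omega
    have hLj : (0 : ℤ) ≤ (P.L : ℤ) ^ j := pow_nonneg (Int.natCast_nonneg P.L) j
    have : (P.L : ℤ) ^ j * (((P.L - 1) / 2 : ℕ) : ℤ) ≤ (P.L : ℤ) ^ j * (P.L : ℤ) := mul_le_mul_of_nonneg_left hh hLj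
    have hc : ((w + P.L ^ (j + 1) : ℕ) : ℤ) = (w : ℤ) + (P.L : ℤ) ^ j * (P.L : ℤ) := by push_cast; ring
    rw [hc]
    linarith
  · rw [Pi.add_apply, add_sub_cancel_left, abs_mul, abs_pow, abs_of_nonneg (Int.natCast_nonneg P.L)]
    exact mul_le_mul_of_nonneg_left (he ν) (pow_nonneg (Int.natCast_nonneg P.L) j)
  · rw [cover_add_eq_embIter_add j hzx' (x - emb (blockOf x)) e hxe, add_sub_cancel]

/-- The size of the labels `±δ_μ` of a unit step. [folklore] -/
theorem abs_single_one_le (μ ν : Fin P.d) : |(Pi.single μ (1 : ℤ) : Fin P.d → ℤ) ν| ≤ 1 := by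
  by_cases h : ν = μ
  · subst h; simp
  · simp [Pi.single_eq_of_ne h]

/-- **A FORWARD UNIT STEP OF `T^{(j)}` MOVES THE COVER POINT BY `L^j`**. [cite: Balaban1987RG1, (0.1) p.251] -/
theorem exists_cover_embIter_shift {j : ℕ} {S : ℕ} {a₀ : Pt P.d} {w : ℕ} (y : Site P j) (μ : Fin P.d) {z : Pt P.d}
    (hz : z ∈ cubeExt S a₀ (w : ℤ)) (hzy : cover P z = embIter j y) :
    ∃ z' ∈ cubeExt S a₀ ((w + P.L ^ j : ℕ) : ℤ), cover P z' = embIter j (y.shift μ) := by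
  refine ⟨z + fun ν => (P.L : ℤ) ^ j * (Pi.single μ (1 : ℤ) : Fin P.d → ℤ) ν, ?_, ?_⟩
  · have h := mem_cubeExt_add_of_near (z' := z + fun ν => (P.L : ℤ) ^ j * (Pi.single μ (1 : ℤ) : Fin P.d → ℤ) ν) (w := (P.L : ℤ) ^ j) hz
      fun ν => by
        rw [Pi.add_apply, add_sub_cancel_left, abs_mul, abs_pow, abs_of_nonneg (Int.natCast_nonneg P.L)]
        calc (P.L : ℤ) ^ j * |(Pi.single μ (1 : ℤ) : Fin P.d → ℤ) ν| ≤ (P.L : ℤ) ^ j * 1 :=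
              mul_le_mul_of_nonneg_left (abs_single_one_le μ ν) (pow_nonneg (Int.natCast_nonneg P.L) j)
          _ = (P.L : ℤ) ^ j := mul_one _
    simpa only [Nat.cast_add, Nat.cast_pow] using h
  · rw [← Site.add_zero_shift y μ]
    exact cover_add_eq_embIter_add j hzy _ _ (zero_shift_apply_eq_intCast μ)

/-- **A BACKWARD UNIT STEP OF `T^{(j)}` MOVES THE COVER POINT BY `L^j`**. [cite: Balaban1987RG1, (0.1) p.251] -/
theorem exists_cover_embIter_unshift {j : ℕ} {S : ℕ} {a₀ : Pt P.d} {w : ℕ} (y : Site P j) (μ : Fin P.d) {z : Pt P.d}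
    (hz : z ∈ cubeExt S a₀ (w : ℤ)) (hzy : cover P z = embIter j y) :
    ∃ z' ∈ cubeExt S a₀ ((w + P.L ^ j : ℕ) : ℤ), cover P z' = embIter j (y.unshift μ) := by
  refine ⟨z + fun ν => (P.L : ℤ) ^ j * (-((Pi.single μ (1 : ℤ) : Fin P.d → ℤ) ν)), ?_, ?_⟩
  · have h := mem_cubeExt_add_of_near (z' := z + fun ν => (P.L : ℤ) ^ j * (-((Pi.single μ (1 : ℤ) : Fin P.d → ℤ) ν))) (w := (P.L : ℤ) ^ j) hz
      fun ν => by
        rw [Pi.add_apply, add_sub_cancel_left, abs_mul, abs_pow, abs_of_nonneg (Int.natCast_nonneg P.L), abs_neg]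
        calc (P.L : ℤ) ^ j * |(Pi.single μ (1 : ℤ) : Fin P.d → ℤ) ν| ≤ (P.L : ℤ) ^ j * 1 :=
              mul_le_mul_of_nonneg_left (abs_single_one_le μ ν) (pow_nonneg (Int.natCast_nonneg P.L) j)
          _ = (P.L : ℤ) ^ j := mul_one _
    simpa only [Nat.cast_add, Nat.cast_pow] using h
  · rw [← Site.add_zero_unshift y μ]
    exact cover_add_eq_embIter_add j hzy _ _ (zero_unshift_apply_eq_intCast μ)

/-- **★ THE CORNER OF A PLAQUETTE NEAR A COARSE BOND WITH AN ENDPOINT IN `□^{∼n}` LIES IN THE `(nS + 3L^{k+1})`-COLLAR**: a `k`-plaquette `q` based in one of the three blocks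
`B(c′₋ − e)`, `B(c′₋)`, `B(c′₊)` around a coarse bond `c′` one of whose endpoints `ι_{k+1}(·)` lies in `□^{∼n}` has its corner `ι_k q₋` covered by a point of the collar of width
`nS + 3L^{k+1}` (two coarse steps and one block radius). [cite: Balaban1987RG1, (0.1) p.251, (0.3) p.252, (0.4) p.253] -/
theorem exists_cover_corner_of_near_bond {k : ℕ} (hk : k + 1 ≤ P.m + P.K) {S : ℕ} (a₀ : Pt P.d) (n : ℕ) (c : PBond P (k + 1))
    (hc : embIter (k + 1) c.src ∈ cubeEnl P S a₀ n ∨ embIter (k + 1) c.tgt ∈ cubeEnl P S a₀ n) (q : Plaq P k)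
    (hq : blockOf q.src = c.src.unshift c.dir ∨ blockOf q.src = c.src ∨ blockOf q.src = c.tgt) :
    ∃ z ∈ cubeExt S a₀ ((n * S + 3 * P.L ^ (k + 1) : ℕ) : ℤ), cover P z = embIter k q.src := by
  -- from a covered coarse site `y` with `blockOf q₋ ∈ {y − e, y, y + e}` and collar width `W`, the corner is covered within `W + 2L^{k+1}`
  have key : ∀ (y : Site P (k + 1)) (W : ℕ), (∃ z ∈ cubeExt S a₀ (W : ℤ), cover P z = embIter (k + 1) y) →
      (blockOf q.src = y.unshift c.dir ∨ blockOf q.src = y ∨ blockOf q.src = y.shift c.dir) →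
      ∃ z ∈ cubeExt S a₀ ((W + 2 * P.L ^ (k + 1) : ℕ) : ℤ), cover P z = embIter k q.src := by
    rintro y W ⟨z, hz, hzy⟩ h
    have widen : ∀ {W' : ℕ}, W' ≤ W + 2 * P.L ^ (k + 1) → (∃ z ∈ cubeExt S a₀ (W' : ℤ), cover P z = embIter k q.src) →
        ∃ z ∈ cubeExt S a₀ ((W + 2 * P.L ^ (k + 1) : ℕ) : ℤ), cover P z = embIter k q.src := by
      rintro W' hW' ⟨z', hz', hz'q⟩
      exact ⟨z', cubeExt_mono a₀ (by exact_mod_cast hW') hz', hz'q⟩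
    have he0 : (0 : ℤ) ≤ (P.L : ℤ) ^ (k + 1) := pow_nonneg (Int.natCast_nonneg P.L) (k + 1)
    have hLk : P.L ^ (k + 1) ≤ 2 * P.L ^ (k + 1) := Nat.le_mul_of_pos_left _ (by norm_num)
    rcases h with h | h | h
    · obtain ⟨z₁, hz₁, hz₁y⟩ := exists_cover_embIter_unshift y c.dir hz hzy
      rw [← h] at hz₁y
      obtain ⟨z₂, hz₂, hz₂q⟩ := exists_cover_embIter_of_cover_blockOf hk q.src hz₁ hz₁y
      exact widen (by omega) ⟨z₂, hz₂, hz₂q⟩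
    · rw [← h] at hzy
      obtain ⟨z₂, hz₂, hz₂q⟩ := exists_cover_embIter_of_cover_blockOf hk q.src hz hzy
      exact widen (by omega) ⟨z₂, hz₂, hz₂q⟩
    · obtain ⟨z₁, hz₁, hz₁y⟩ := exists_cover_embIter_shift y c.dir hz hzy
      rw [← h] at hz₁y
      obtain ⟨z₂, hz₂, hz₂q⟩ := exists_cover_embIter_of_cover_blockOf hk q.src hz₁ hz₁y
      exact widen (by omega) ⟨z₂, hz₂, hz₂q⟩
  have he0 : (0 : ℤ) ≤ (P.L : ℤ) ^ (k + 1) := pow_nonneg (Int.natCast_nonneg P.L) (k + 1)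
  rcases hc with hc | hc
  · obtain ⟨z, hz, hzc⟩ := hc
    obtain ⟨z', hz', hz'q⟩ := key c.src (n * S) ⟨z, hz, hzc⟩ hq
    exact ⟨z', cubeExt_mono a₀ (by push_cast; omega) hz', hz'q⟩
  · obtain ⟨z, hz, hzc⟩ := hc
    -- `c′₋ = c′₊ − e`: one backward step from the covered target
    obtain ⟨z₁, hz₁, hz₁s⟩ := exists_cover_embIter_unshift c.tgt c.dir hz hzc
    have hsrc : c.tgt.unshift c.dir = c.src := Site.unshift_shift c.src c.dir
    rw [hsrc] at hz₁s
    obtain ⟨z', hz', hz'q⟩ := key c.src (n * S + P.L ^ (k + 1)) ⟨z₁, hz₁, hz₁s⟩ hq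
    exact ⟨z', cubeExt_mono a₀ (by push_cast; omega) hz', hz'q⟩

/-- **A SITE WITHIN TWO STEPS OF A COVERED SITE LIES IN `□^{∼n′}`** once the collar width plus `2L^k` fits: `w + 2L^k ≤ n′S`. [cite: Balaban1987RG1, (0.1) p.251] -/
theorem embIter_add_mem_cubeEnl {k : ℕ} {S : ℕ} {a₀ : Pt P.d} {w n' : ℕ} (hw : w + 2 * P.L ^ k ≤ n' * S) {x : Site P k} {z : Pt P.d}
    (hz : z ∈ cubeExt S a₀ (w : ℤ)) (hzx : cover P z = embIter k x) (a : Site P k) (v : Fin P.d → ℤ) (hv : ∀ ν, |v ν| ≤ 2)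
    (ha : ∀ ν, a ν = ((v ν : ℤ) : ZMod (P.sitesPerDir k))) : embIter k (x + a) ∈ cubeEnl P S a₀ n' := by
  refine ⟨z + fun ν => (P.L : ℤ) ^ k * v ν, ?_, cover_add_eq_embIter_add k hzx a v ha⟩
  have hw' : (w : ℤ) + 2 * (P.L : ℤ) ^ k ≤ ((n' * S : ℕ) : ℤ) := by exact_mod_cast hw
  refine cubeExt_mono a₀ hw' (mem_cubeExt_add_of_near hz fun ν => ?_)
  rw [Pi.add_apply, add_sub_cancel_left, abs_mul, abs_pow, abs_of_nonneg (Int.natCast_nonneg P.L)]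
  calc (P.L : ℤ) ^ k * |v ν| ≤ (P.L : ℤ) ^ k * 2 := mul_le_mul_of_nonneg_left (hv ν) (pow_nonneg (Int.natCast_nonneg P.L) k)
    _ = 2 * (P.L : ℤ) ^ k := mul_comm _ _

end Geometry

/-! ## §3  At def-T's (3.2) ∕ (3.3) ∕ (3.4) data of record: small plaquettes of the old field near every coarse bond of the cube -/

section Record

open Node00 B14.Eq218Concrete B14.Sect3Decomp

variable (F : T4Family) (N : ℕ) [NeZero N] (ν : Stage7Numerics) (M : ℕ) (p : B12.RunParams) (g : ℕ → ℝ)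

/-- **★★ (3.2) + (3.3) AT A χ-CUBE ⇒ THE OLD FIELD'S LEVEL-`k` PLAQUETTES NEAR EVERY COARSE BOND OF THE CUBE ARE SMALL.**  At def-T's `sect3DataOfRecord` (χ-cubes `□` of side
`S = sideχ`, `plaqT □ = plaqInside □^∼`, `bondsStar □ = (□^{∼2})^{(k)*}`, `UkLoc □ = U_{k+1,□}` of (2.16), `Vbox = M^k(U_{k+1,□})` of (3.4)): IF the (3.2) event
`|U_{k+1,□}(V′)(∂p) − 1| < ε_{k+1}η_{k+1}²` holds on `p ⊂ □^∼`, the (3.3) event `|U(b)·V^{(k)}_□(V′)(b)⁻¹ − 1| < 2δ` holds on `b ∈ (□^{∼2})^{(k)*}`, the cube is large against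
two coarse steps and the averaging boxes (`3L^{k+1} + R₀·Σ_{l<k}L^l + 2 ≤ S`), and [B7] Prop. 2's numerics hold for `α₀ := ε_{k+1}∕L²` (`ε_{k+1}η_{k+1}² = α₀η_k²`), THEN for
every coarse bond `c′` with an endpoint in `□` and every `k`-plaquette `q` based in `B(c′₋ − e) ∪ B(c′₋) ∪ B(c′₊)`: `|U(∂q) − 1| < 4·(2δ) + 2ε_{k+1}∕L²` — dag-n08-w2's
four-bond telescoping against `W := V^{(k)}_□(V′)` (the four (3.3) bonds by §2) plus §1 at the corner of `q` (§2).  This is the letter of dag-n11-w6's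
`loops_small_of_plaqSmallOn_blocks` at `c′`, and dag-n08-w2's background row `hbg` DISCHARGED at these plaquettes.
[cite: Balaban1988Convergent, (3.2)-(3.4) p.265; Balaban1985Averaging, (19)-(20) p.21, Prop. 2 (52)-(54) p.26; Balaban1987RG1, (0.1) p.251, (0.4) p.253] -/
theorem plaqHol_small_near_of_sect3Events {k : ℕ} (hk : k + 1 ≤ (F.P p.K).m + (F.P p.K).K) (s : SeqOfRecord F ν M g p.K k) (c : Iχ F ν p g k)
    (hR : 3 * (F.P p.K).L ^ (k + 1) + (((F.P p.K).d + 4) * (F.P p.K).L + 2) * (∑ l ∈ Finset.range k, (F.P p.K).L ^ l) + 2 ≤ sideχ F ν p g k)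
    (hε : 0 < epsOfRecord ν g (k + 1))
    (hα3 : (143 * (((((F.P p.K).d + 4 : ℕ) : ℝ)) ^ 2 / 4) ^ 2) * (epsOfRecord ν g (k + 1) / ((F.P p.K).L : ℝ) ^ 2) ≤ 1 / 3)
    (hα2 : 2 * (epsOfRecord ν g (k + 1) / ((F.P p.K).L : ℝ) ^ 2) ≤ 2 * deltaSU (Fin N) / ((((F.P p.K).d + 4) * (F.P p.K).L : ℕ) : ℝ) ^ 2)
    {twoδ : ℝ} (U : GaugeField (F.P p.K) k (SU N)) (V' : GaugeField (F.P p.K) (k + 1) (SU N))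
    (h32 : PlaqSmallOn ((sect3DataOfRecord F N ν M p g k s).plaqT c) (epsOfRecord ν g (k + 1) * (F.P p.K).eta (k + 1) ^ 2)
      ((sect3DataOfRecord F N ν M p g k s).UkLoc c V'))
    (h33 : SmallApproxFluct (sect3DataOfRecord F N ν M p g k s) (avOfRecord F N p.K) twoδ U V' c)
    (c' : PBond (F.P p.K) (k + 1)) (hc' : embIter (k + 1) c'.src ∈ cubeχ F ν p g k c ∨ embIter (k + 1) c'.tgt ∈ cubeχ F ν p g k c)
    (q : Plaq (F.P p.K) k) (hq : blockOf q.src = c'.src.unshift c'.dir ∨ blockOf q.src = c'.src ∨ blockOf q.src = c'.tgt) :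
    dist1 (GaugeField.plaqHol U q) < 4 * twoδ + 2 * (epsOfRecord ν g (k + 1) / ((F.P p.K).L : ℝ) ^ 2) := by
  -- the corner of `q` in the `3L^{k+1}`-collar of `□`
  have hc'' : embIter (k + 1) c'.src ∈ cubeEnl (F.P p.K) (sideχ F ν p g k) c 0 ∨ embIter (k + 1) c'.tgt ∈ cubeEnl (F.P p.K) (sideχ F ν p g k) c 0 := hc'
  obtain ⟨z, hz, hzq⟩ := exists_cover_corner_of_near_bond hk (c : Pt (F.P p.K).d) 0 c' hc'' q hq
  rw [zero_mul, zero_add] at hz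
  -- (3.4): the top-scale plaquette of `V^{(k)}_□ = M^k(U_{k+1,□}(V′))` at `q`, by the local k-fold [B7] Prop. 2 (§2) from the (3.2) event
  have heta : epsOfRecord ν g (k + 1) * (F.P p.K).eta (k + 1) ^ 2 =
      epsOfRecord ν g (k + 1) / ((F.P p.K).L : ℝ) ^ 2 * (F.P p.K).eta k ^ 2 := by
    rw [Params.eta, Params.eta, pow_succ]
    ring
  have hloc : PlaqSmallOn (plaqInside (cubeEnl (F.P p.K) (sideχ F ν p g k) c 1))
      (epsOfRecord ν g (k + 1) / ((F.P p.K).L : ℝ) ^ 2 * (F.P p.K).eta k ^ 2) ((sect3DataOfRecord F N ν M p g k s).UkLoc c V') := by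
    rw [← heta]
    exact h32
  have hα : 0 < epsOfRecord ν g (k + 1) / ((F.P p.K).L : ℝ) ^ 2 := by
    have : (0 : ℝ) < ((F.P p.K).L : ℝ) := by exact_mod_cast (F.P p.K).L_pos
    positivity
  have hV : dist1 (GaugeField.plaqHol (Vbox (sect3DataOfRecord F N ν M p g k s) (avOfRecord F N p.K) c V') q) <
      2 * (epsOfRecord ν g (k + 1) / ((F.P p.K).L : ℝ) ^ 2) :=
    plaqHol_iter_avOfRecord_small_of_collar F N p.K k (c : Pt (F.P p.K).d) (3 * (F.P p.K).L ^ (k + 1)) hR hα hα3 hα2 hloc ⟨z, hz, hzq⟩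
  -- the four bonds of `∂q` lie in `(□^{∼2})^{(k)*}` (§3), where the (3.3) event compares `U` with `V^{(k)}_□(V′)`
  have hLk : (F.P p.K).L ^ k ≤ (F.P p.K).L ^ (k + 1) := Nat.pow_le_pow_right (F.P p.K).L_pos (Nat.le_succ k)
  have hw2 : 3 * (F.P p.K).L ^ (k + 1) + 2 * (F.P p.K).L ^ k ≤ 2 * sideχ F ν p g k := by omega
  have mv : ∀ (a : Site (F.P p.K) k) (v : Fin (F.P p.K).d → ℤ), (∀ ι, |v ι| ≤ 2) →
      (∀ ι, a ι = ((v ι : ℤ) : ZMod ((F.P p.K).sitesPerDir k))) → embIter k (q.src + a) ∈ cubeEnl (F.P p.K) (sideχ F ν p g k) c 2 :=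
    fun a v hv ha => embIter_add_mem_cubeEnl hw2 hz hzq a v hv ha
  have hb2 : ∀ μ ι : Fin (F.P p.K).d, |(Pi.single μ (1 : ℤ) : Fin (F.P p.K).d → ℤ) ι| ≤ 2 :=
    fun μ ι => (abs_single_one_le μ ι).trans (by norm_num)
  have p0 : embIter k q.src ∈ cubeEnl (F.P p.K) (sideχ F ν p g k) c 2 := by
    simpa using mv 0 0 (fun ι => by simp) (fun ι => by simp [Site.zero_apply])
  have p1 : ∀ μ : Fin (F.P p.K).d, embIter k (q.src.shift μ) ∈ cubeEnl (F.P p.K) (sideχ F ν p g k) c 2 := fun μ => by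
    rw [← Site.add_zero_shift]
    exact mv _ _ (hb2 μ) (zero_shift_apply_eq_intCast μ)
  have p2 : ∀ μ μ' : Fin (F.P p.K).d, embIter k ((q.src.shift μ).shift μ') ∈ cubeEnl (F.P p.K) (sideχ F ν p g k) c 2 := fun μ μ' => by
    rw [← Site.add_zero_shift, ← Site.add_zero_shift, add_assoc]
    refine mv _ (fun ι => (Pi.single μ (1 : ℤ) : Fin (F.P p.K).d → ℤ) ι + (Pi.single μ' (1 : ℤ) : Fin (F.P p.K).d → ℤ) ι)
      (fun ι => ?_) fun ι => ?_
    · have h1 := abs_single_one_le μ ι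
      have h2 := abs_single_one_le μ' ι
      exact (abs_add_le _ _).trans (by linarith)
    · rw [Site.add_apply, zero_shift_apply_eq_intCast, zero_shift_apply_eq_intCast, Int.cast_add]
  have hbond : ∀ b : PBond (F.P p.K) k, embIter k b.src ∈ cubeEnl (F.P p.K) (sideχ F ν p g k) c 2 →
      embIter k b.tgt ∈ cubeEnl (F.P p.K) (sideχ F ν p g k) c 2 → b ∈ (sect3DataOfRecord F N ν M p g k s).bondsStar c := by
    intro b h1 h2
    classical
    simp only [sect3DataOfRecord, Finset.mem_filter, Finset.mem_univ, true_and]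
    exact ⟨h1, h2⟩
  -- dag-n08-w2's four-bond telescoping under (3.3), against `W := V^{(k)}_□(V′)`
  have hlt := dist1_plaqHol_lt_of_smallApproxFluct (sect3DataOfRecord F N ν M p g k s) (avOfRecord F N p.K) h33 q
    (hbond ⟨q.src, q.μ⟩ p0 (p1 q.μ)) (hbond ⟨q.src.shift q.μ, q.ν⟩ (p1 q.μ) (p2 q.μ q.ν))
    (hbond ⟨q.src.shift q.ν, q.μ⟩ (p1 q.ν) (p2 q.ν q.μ)) (hbond ⟨q.src, q.ν⟩ p0 (p1 q.ν)) hV.le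
  linarith

/-! ## §4  From a non-zero step weight: small plaquettes near every coarse bond with an endpoint in `Ω_{k+1}(s′)` -/

/-- **★★ THE SUPPORT CLAUSE IN PLAQUETTE CURRENCY, FROM `w_k(s′) ≠ 0`.**  With this seat's `…N11StepWeightSupportOfRecord.support_of_wOfRecord_ne_zero` (a non-zero step weight forces the
(3.2) ∕ (3.3) events at every χ-cube `□ ⊆ Ω_{k+1}(s′)`, `0 < sideD`): IF moreover `Ω_{k+1}(s′)` is covered by the χ-cubes it contains (`hcov` — the cube-cover reading
`L·M₂ ∣ M`, located by dag-n11-d g12; displayed), the χ-cubes are large (`hR`) and [B7] Prop. 2's numerics hold for `α₀ := ε_{k+1}∕L²`, THEN wherever `w_k(s′)(U, V′) ≠ 0`,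
every `k`-plaquette `q` based in the three blocks around ANY coarse bond `c′` with an endpoint in `Ω_{k+1}(s′)` satisfies `|U(∂q) − 1| < 4·(2δ_k) + 2ε_{k+1}∕L²` — the
hypothesis of dag-n11-w6's `exists_chart_transportOfRecord_ae_eq_of_plaqSmallSupport` at those bonds, `δ := 8δ_k + 2ε_{k+1}∕L²` (its window numerics `((d+2)L)²∕4·δ ≤ α` stay
the consumer's). [cite: Balaban1988Convergent, (3.2)-(3.5) p.265, p.267; Balaban1985Averaging, Prop. 2 (52)-(54) p.26; Balaban1987RG1, (0.4) p.253] -/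
theorem plaqHol_small_near_of_wOfRecord_ne_zero {k : ℕ} (hk : k + 1 ≤ (F.P p.K).m + (F.P p.K).K) (A₁ : ℝ) (ζ : ZetaOfRecord F N ν M)
    (hD : 0 < sideD F ν M p g k)
    (hR : 3 * (F.P p.K).L ^ (k + 1) + (((F.P p.K).d + 4) * (F.P p.K).L + 2) * (∑ l ∈ Finset.range k, (F.P p.K).L ^ l) + 2 ≤ sideχ F ν p g k)
    (hε : 0 < epsOfRecord ν g (k + 1))
    (hα3 : (143 * (((((F.P p.K).d + 4 : ℕ) : ℝ)) ^ 2 / 4) ^ 2) * (epsOfRecord ν g (k + 1) / ((F.P p.K).L : ℝ) ^ 2) ≤ 1 / 3)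
    (hα2 : 2 * (epsOfRecord ν g (k + 1) / ((F.P p.K).L : ℝ) ^ 2) ≤ 2 * deltaSU (Fin N) / ((((F.P p.K).d + 4) * (F.P p.K).L : ℕ) : ℝ) ^ 2)
    (s' : SeqOfRecord F ν M g p.K (k + 1)) (U : GaugeField (F.P p.K) k (SU N)) (V' : GaugeField (F.P p.K) (k + 1) (SU N))
    (hw : wOfRecord F N ν M A₁ ζ p g k s' U V' ≠ 0)
    (hcov : ∀ y ∈ s'.Ω (k + 1), ∃ c ∈ cubesIn (cubeχ F ν p g k) (s'.Ω (k + 1)), y ∈ cubeχ F ν p g k c)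
    (c' : PBond (F.P p.K) (k + 1)) (hc' : embIter (k + 1) c'.src ∈ s'.Ω (k + 1) ∨ embIter (k + 1) c'.tgt ∈ s'.Ω (k + 1))
    (q : Plaq (F.P p.K) k) (hq : blockOf q.src = c'.src.unshift c'.dir ∨ blockOf q.src = c'.src ∨ blockOf q.src = c'.tgt) :
    dist1 (GaugeField.plaqHol U q) < 4 * (2 * deltaOfRecord ν g k A₁) + 2 * (epsOfRecord ν g (k + 1) / ((F.P p.K).L : ℝ) ^ 2) := by
  obtain ⟨t, -, hev⟩ :=
    BalabanUVNodesN11StepWeightSupportOfRecord.support_of_wOfRecord_ne_zero ν M A₁ ζ p g k hD s' U V' hw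
  -- a χ-cube `□ ⊆ Ω_{k+1}(s′)` containing the endpoint of `c′`
  have hcube : ∃ c ∈ cubesIn (cubeχ F ν p g k) (s'.Ω (k + 1)),
      embIter (k + 1) c'.src ∈ cubeχ F ν p g k c ∨ embIter (k + 1) c'.tgt ∈ cubeχ F ν p g k c := by
    rcases hc' with h | h
    · obtain ⟨c, hc, hy⟩ := hcov _ h
      exact ⟨c, hc, Or.inl hy⟩
    · obtain ⟨c, hc, hy⟩ := hcov _ h
      exact ⟨c, hc, Or.inr hy⟩
  obtain ⟨c, hc, hyc⟩ := hcube
  obtain ⟨h32, h33⟩ := hev c hc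
  exact plaqHol_small_near_of_sect3Events F N ν M p g hk s'.init c hR hε hα3 hα2 U V' h32 h33 c' hyc q hq

end Record

end Summit.QuantumFields.YangMills.Theorems.BalabanUVNodesN11PlaqSmallOfSect3Events

end
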